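import Mathlib.FieldTheory.Finite.Basic
import Mathlib.Data.Nat.Totient
import Mathlib.NumberTheory.Divisors
import Mathlib.Algebra.BigOperators.Ring.Finset
import Mathlib.Tactic.LinearCombination
import Mathlib.Tactic.Ring
import Summits.BirchSwinnertonDyer.BirchSwinnertonDyer.Theorems.Rank2ShaFermatQuotientTaylor
import HarnessLib

/-!
# BirchSwinnertonDyer — rank-2 `Ш[p^∞]` cell, STRUCTURE track: Euler/Kummer-in-the-weight and Vélu bookkeeping (T19)

HONEST FRAMING (cell `b2b-bsdr2sha`, run/shared/lean/b2b/bsd-rank2-sha/, structure/THEORY-NOTE-C5.md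
supplement 20, (20.6) «the Lean side: T19 = the ring identities of 20.2(b),(e) (Kummer/Euler bookkeeping as polynomial
congruences) and the Vélu power-sum identities of 20.3(iv) — for P2/referee to judge»): ELEMENTARY number theory and
commutative algebra only — Euler's theorem in the exponent `1 + φ(p^a)`, the resulting divisor-sum congruence, the
binomial congruence `(1 + p·y)^{p^a} ≡ 1 (mod p^{a+1})`, two one-line `V`-factor congruences, and the two Vélu
coefficient sums as `Finset` identities. Nothing here concerns BSD, `Ш`, `L`-values, heights or any census number; NOT
typed (they are the modular-forms inputs of 20.2 and stay hypotheses of the note): the Kummer congruence for the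
Bernoulli factor `(1 − p^{k−1})B_k/k ≡ (1 − p)B₂/2`, the `q`-expansion principle, `E_{p−1} ≡ 1 (mod p)`, Katz's
Frobenius/`V` on ordinary test objects, the canonical subgroup, and Vélu's isogeny itself. No definition, no named fact,
no axiom. Companion of T14a (`Rank2ShaFermatQuotientTaylor`, whose `exists_one_add_pow_eq` is reused), T15, T17, T18.

WHAT IS TYPED.
* (20.2(b), Euler in the weight) for `d` prime to `m`: `d^{1 + φ(m)·j} ≡ d (mod m)` [`pow_one_add_totient_mul_modEq`,
  `pow_one_add_totient_modEq`]; for a prime `p ∣ d`: `p^a ∣ d^{1 + φ(p^a)}` (because `a ≤ φ(p^a)`) [`le_totient_prime_pow`,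
  `prime_pow_dvd_pow_one_add_totient`]; together, in `ZMod (p^a)`: `d^{1+φ(p^a)} = [p ∤ d]·d` [`cast_pow_one_add_totient`],
  hence the divisor-sum congruence **`σ_{φ(p^a)+1}(n) ≡ σ₁^{(p)}(n) := Σ_{d ∣ n, p ∤ d} d (mod p^a)`**
  [`sum_divisors_pow_eq_sum_coprime`] — at `a = 3` this is «`σ_{k−1} ≡ σ₁^{(p)} (mod p³)` for `k − 1 = 1 + φ(p³)`», the
  weight used being `k = 2 + (p − 1)p²` [`weight_sub_one_eq`]; at `a = 2` the `K₂` weight `2 + (p−1)p` [`weight₂_sub_one_eq`].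
* (20.2(b), «equal weight via `E_{p−1}^{p²} ≡ 1 (mod p³)`», ring skeleton) in any commutative ring:
  `(1 + p·y)^{p^a} ≡ 1 (mod p^{a+1})` [`prime_pow_succ_dvd_one_add_mul_pow_sub_one`], in particular
  `(1 + p·y)^p ≡ 1 (mod p²)` and `(1 + p·y)^{p²} ≡ 1 (mod p³)` [`sq_dvd_…`, `cube_dvd_…`].
* (P-024 / 20.1, the `V`-factors) `w ≡ 1 (mod p) ⟹ (1 − p + p·w) ≡ 1 (mod p²)` and `(1 − p²·w) ≡ 1 − p² (mod p³)`
  [`sq_dvd_VFactor_sub_one`, `cube_dvd_VFactor₃_sub`] (read `w = a_p^{−2}` resp. `a_p^{−4}` when `a_p ≡ ±1 (mod p)`), and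
  `a⁴ = 1` for a unit of `ZMod 5` [`pow_four_eq_one_zmod_five`] (20.2(d): `a_5⁴ ≡ 1` always).
* (20.3(iv), Vélu's coefficient sums) for any finite index set `S` («half-set» of the kernel) and `x : S → R`:
  `Σ_S (6x_Q² + b₂x_Q + b₄) = 6P₂ + b₂P₁ + |S|·b₄` and `Σ_S (u_Q + x_Q·t_Q) = 10P₃ + 2b₂P₂ + 3b₄P₁ + |S|·b₆` with
  `t_Q = 6x_Q² + b₂x_Q + b₄`, `u_Q = 4x_Q³ + b₂x_Q² + 2b₄x_Q + b₆`, `P_i = Σ_S x_Q^i` [`velu_t_sum`, `velu_w_sum`].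

References: the cell's THEORY-NOTE-C5.md supplements 19–20 (LEAD g10, 2026-08-24); Mathlib `Nat.ModEq.pow_totient`
(Euler), `Nat.totient_prime_pow`, `Nat.divisors`.
-/

set_option autoImplicit false

-- single-conjunct summit: `Summit.BirchSwinnertonDyer.BirchSwinnertonDyer.…` repeats the name by design
set_option linter.dupNamespace false

open Finset

namespace Summit.BirchSwinnertonDyer.BirchSwinnertonDyer.Rank2Sha.Structure.KatzBookkeeping

open Summit.BirchSwinnertonDyer.BirchSwinnertonDyer.Rank2Sha.Structure.TaylorFQ (exists_one_add_pow_eq)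

/-! ### Euler in the weight (20.2(b)) -/

/-- **Euler in the exponent.** For `d` prime to `m` and any `j`: `d^{1 + φ(m)·j} ≡ d (mod m)`. -/
theorem pow_one_add_totient_mul_modEq {m d : ℕ} (h : d.Coprime m) (j : ℕ) :
    d ^ (1 + m.totient * j) ≡ d [MOD m] := by
  have h1 : d ^ m.totient ≡ 1 [MOD m] := Nat.ModEq.pow_totient h
  have h2 : d ^ (m.totient * j) ≡ 1 [MOD m] := by
    rw [pow_mul]
    simpa using h1.pow j
  calc d ^ (1 + m.totient * j) = d * d ^ (m.totient * j) := by rw [pow_add, pow_one]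
    _ ≡ d * 1 [MOD m] := h2.mul_left d
    _ = d := mul_one d

/-- `d^{1 + φ(m)} ≡ d (mod m)` for `d` prime to `m` (the case `j = 1`). -/
theorem pow_one_add_totient_modEq {m d : ℕ} (h : d.Coprime m) : d ^ (1 + m.totient) ≡ d [MOD m] := by
  simpa using pow_one_add_totient_mul_modEq h 1

/-- For a prime `p`: `a ≤ φ(p^a)` (`φ(p^a) = p^{a−1}(p − 1) ≥ 2^{a−1} ≥ a`). -/
theorem le_totient_prime_pow {p : ℕ} (hp : p.Prime) (a : ℕ) : a ≤ (p ^ a).totient := by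
  rcases Nat.eq_zero_or_pos a with rfl | ha
  · simp
  rw [Nat.totient_prime_pow hp ha]
  have h2 : a - 1 < 2 ^ (a - 1) := Nat.lt_two_pow_self
  have h3 : 2 ^ (a - 1) ≤ p ^ (a - 1) := Nat.pow_le_pow_left hp.two_le _
  have h4 : 1 ≤ p - 1 := by have := hp.two_le; omega
  calc a ≤ 2 ^ (a - 1) := by omega
    _ ≤ p ^ (a - 1) := h3
    _ = p ^ (a - 1) * 1 := (mul_one _).symm
    _ ≤ p ^ (a - 1) * (p - 1) := Nat.mul_le_mul_left _ h4

/-- For a prime `p ∣ d`: `p^a ∣ d^{1 + φ(p^a)}` (the `p ∣ d` divisors die modulo `p^a`). -/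
theorem prime_pow_dvd_pow_one_add_totient {p d : ℕ} (hp : p.Prime) (a : ℕ) (hd : p ∣ d) :
    p ^ a ∣ d ^ (1 + (p ^ a).totient) :=
  (pow_dvd_pow_of_dvd hd a).trans (pow_dvd_pow d (by have := le_totient_prime_pow hp a; omega))

/-- **Both cases in `ZMod (p^a)`:** `d^{1+φ(p^a)}` is `0` if `p ∣ d` and `d` otherwise. -/
theorem cast_pow_one_add_totient {p : ℕ} (hp : p.Prime) (a d : ℕ) :
    ((d ^ (1 + (p ^ a).totient) : ℕ) : ZMod (p ^ a)) = if p ∣ d then 0 else (d : ZMod (p ^ a)) := by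
  split_ifs with h
  · exact (ZMod.natCast_eq_zero_iff _ _).mpr (prime_pow_dvd_pow_one_add_totient hp a h)
  · have hcop : d.Coprime (p ^ a) := (((Nat.Prime.coprime_iff_not_dvd hp).mpr h).symm).pow_right a
    exact (ZMod.natCast_eq_natCast_iff _ _ _).mpr (pow_one_add_totient_modEq hcop)

/-- **The divisor-sum congruence of 20.2(b):** `σ_{1+φ(p^a)}(n) ≡ σ₁^{(p)}(n) = Σ_{d ∣ n, p ∤ d} d (mod p^a)`, stated
as an equality in `ZMod (p^a)`. At `a = 3`: `σ_{k−1}(n) ≡ σ₁^{(p)}(n) (mod p³)` for `k = 2 + (p−1)p²`. -/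
theorem sum_divisors_pow_eq_sum_coprime {p : ℕ} (hp : p.Prime) (a n : ℕ) :
    (∑ d ∈ n.divisors, (((d ^ (1 + (p ^ a).totient) : ℕ) : ZMod (p ^ a)))) =
      ∑ d ∈ n.divisors.filter (fun d => ¬ p ∣ d), (d : ZMod (p ^ a)) := by
  rw [Finset.sum_filter]
  refine Finset.sum_congr rfl fun d _ => ?_
  rw [cast_pow_one_add_totient hp a d]
  by_cases h : p ∣ d <;> simp [h]

/-- The weight of 20.2: for a prime `p`, `(2 + (p − 1)·p²) − 1 = 1 + φ(p³)`. -/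
theorem weight_sub_one_eq {p : ℕ} (hp : p.Prime) : 2 + (p - 1) * p ^ 2 - 1 = 1 + (p ^ 3).totient := by
  rw [Nat.totient_prime_pow hp (by norm_num)]
  have h : (p - 1) * p ^ 2 = p ^ (3 - 1) * (p - 1) := by norm_num [mul_comm]
  omega

/-- The `K₂` weight: `(2 + (p − 1)·p) − 1 = 1 + φ(p²)`. -/
theorem weight₂_sub_one_eq {p : ℕ} (hp : p.Prime) : 2 + (p - 1) * p - 1 = 1 + (p ^ 2).totient := by
  rw [Nat.totient_prime_pow hp (by norm_num)]
  have h : (p - 1) * p = p ^ (2 - 1) * (p - 1) := by norm_num [mul_comm]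
  omega

/-! ### `(1 + p·y)^{p^a} ≡ 1 (mod p^{a+1})` — the ring skeleton of «`E_{p−1}^{p²} ≡ 1 (mod p³)`» -/

section Ring

variable {R : Type*} [CommRing R]

/-- **Binomial congruence.** In any commutative ring, for a natural number `p` (cast) and any `y`:
`(1 + p·y)^{p^a} ≡ 1 (mod p^{a+1})`, by induction on `a` (`(1 + p^{a+1}c)^p = 1 + p^{a+2}(c + r·p^a·c²)`). -/
theorem prime_pow_succ_dvd_one_add_mul_pow_sub_one (p : ℕ) (y : R) (a : ℕ) :
    (p : R) ^ (a + 1) ∣ (1 + (p : R) * y) ^ (p ^ a) - 1 := by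
  induction a with
  | zero => exact ⟨y, by ring⟩
  | succ a ih =>
    obtain ⟨c, hc⟩ := ih
    obtain ⟨r, hr⟩ := exists_one_add_pow_eq ((p : R) ^ (a + 1) * c) p
    have hca : (1 + (p : R) * y) ^ (p ^ a) = 1 + (p : R) ^ (a + 1) * c := by linear_combination hc
    refine ⟨c + r * (p : R) ^ a * c ^ 2, ?_⟩
    rw [pow_succ, pow_mul, hca, hr]
    ring

/-- `(1 + p·y)^p ≡ 1 (mod p²)` (so `E_{p−1} ≡ 1 (mod p)` gives `E_{p−1}^p ≡ 1 (mod p²)`, the `K₂` case). -/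
theorem sq_dvd_one_add_mul_pow_sub_one (p : ℕ) (y : R) : (p : R) ^ 2 ∣ (1 + (p : R) * y) ^ p - 1 := by
  simpa using prime_pow_succ_dvd_one_add_mul_pow_sub_one p y 1

/-- `(1 + p·y)^{p²} ≡ 1 (mod p³)` («equal weight via `E_{p−1}^{p²} ≡ 1 (mod p³)`» of 20.2(b)). -/
theorem cube_dvd_one_add_mul_pow_sq_sub_one (p : ℕ) (y : R) :
    (p : R) ^ 3 ∣ (1 + (p : R) * y) ^ (p ^ 2) - 1 :=
  prime_pow_succ_dvd_one_add_mul_pow_sub_one p y 2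

/-- **`V`-factor of `K₂` (P-024):** if `w ≡ 1 (mod p)` (read `w = a_p^{−2}`, `a_p ≡ ±1 (mod p)`) then
`1 − p + p·w ≡ 1 (mod p²)`. -/
theorem sq_dvd_VFactor_sub_one (p w : R) (hw : p ∣ w - 1) : p ^ 2 ∣ (1 - p + p * w) - 1 := by
  obtain ⟨c, hc⟩ := hw
  exact ⟨c, by linear_combination p * hc⟩

/-- **`V`-factor of `K₃` (20.1):** if `w ≡ 1 (mod p)` (read `w = a_p^{−4}`) then `1 − p²·w ≡ 1 − p² (mod p³)`. -/
theorem cube_dvd_VFactor₃_sub (p w : R) (hw : p ∣ w - 1) : p ^ 3 ∣ (1 - p ^ 2 * w) - (1 - p ^ 2) := by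
  obtain ⟨c, hc⟩ := hw
  exact ⟨-c, by linear_combination (-p ^ 2) * hc⟩

end Ring

/-- 20.2(d) at `p = 5`: `a⁴ = 1` for every unit `a` of `ZMod 5` (so `E₂(E″,ω″) ≡ a_5^{−4}E₂ ≡ E₂ (mod 5)`). -/
theorem pow_four_eq_one_zmod_five (a : ZMod 5) (ha : a ≠ 0) : a ^ 4 = 1 := by
  haveI : Fact (Nat.Prime 5) := ⟨by decide⟩
  simpa using ZMod.pow_card_sub_one_eq_one ha

/-! ### Vélu's coefficient sums (20.3(iv)) -/

section Velu

variable {R : Type*} [CommRing R] {ι : Type*}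

/-- **Vélu, the `t`-sum:** `Σ_{Q∈S} (6x_Q² + b₂x_Q + b₄) = 6·P₂ + b₂·P₁ + |S|·b₄`, `P_i = Σ_S x_Q^i`. -/
theorem velu_t_sum (S : Finset ι) (x : ι → R) (b₂ b₄ : R) :
    ∑ Q ∈ S, (6 * x Q ^ 2 + b₂ * x Q + b₄) =
      6 * ∑ Q ∈ S, x Q ^ 2 + b₂ * ∑ Q ∈ S, x Q + (S.card : R) * b₄ := by
  simp only [Finset.sum_add_distrib, Finset.mul_sum, Finset.sum_const, nsmul_eq_mul]

/-- **Vélu, the `w`-sum:** with `t_Q = 6x_Q² + b₂x_Q + b₄`, `u_Q = 4x_Q³ + b₂x_Q² + 2b₄x_Q + b₆`: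
`Σ_{Q∈S} (u_Q + x_Q·t_Q) = 10·P₃ + 2b₂·P₂ + 3b₄·P₁ + |S|·b₆`. -/
theorem velu_w_sum (S : Finset ι) (x : ι → R) (b₂ b₄ b₆ : R) :
    ∑ Q ∈ S, ((4 * x Q ^ 3 + b₂ * x Q ^ 2 + 2 * b₄ * x Q + b₆) + x Q * (6 * x Q ^ 2 + b₂ * x Q + b₄)) =
      10 * ∑ Q ∈ S, x Q ^ 3 + 2 * b₂ * ∑ Q ∈ S, x Q ^ 2 + 3 * b₄ * ∑ Q ∈ S, x Q + (S.card : R) * b₆ := by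
  have h : ∀ Q, (4 * x Q ^ 3 + b₂ * x Q ^ 2 + 2 * b₄ * x Q + b₆) + x Q * (6 * x Q ^ 2 + b₂ * x Q + b₄) =
      10 * x Q ^ 3 + 2 * b₂ * x Q ^ 2 + 3 * b₄ * x Q + b₆ := fun Q => by ring
  simp only [h, Finset.sum_add_distrib, Finset.mul_sum, Finset.sum_const, nsmul_eq_mul]

end Velu

end Summit.BirchSwinnertonDyer.BirchSwinnertonDyer.Rank2Sha.Structure.KatzBookkeeping
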